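import Summits.QuantumFields.YangMills.Theorems.BalabanUVNodesN11PrivateCoordinateChartKeptParameter
import Summits.QuantumFields.YangMills.Theorems.BalabanUVNodesN11TransportOfRecordInPrivateCoordinateChart
import Literature.MathematicalPhysics.QuantumFieldTheory.Balaban1983to89.Node00.AveragingSkewPresentation

/-!
# DAG node N11 — THE INNER FIBRE-CHART SOCKET OF THE SEPARATED TRANSPORT IN PRIVATE COORDINATES: dag-n11-d's `(κ, Ψ, J, S; hpush, hfib)` of the bond-partition
# presentation INHABITED by resampling ONLY the central bonds of the coarse bonds OFF `sV′` (file 3b; the transport endpoint over p616225 is file 3c)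

HEADER — WORK-UNIT METADATA.  Cell `pub-ymgap`, YM-PLAN Track A (HUMAN RULING D-0062 ∕ D-0149 ∕ D-0154 (3a)), WIDTH SEAT `pub-ymgap-dag-n11-w6` (g2) on node N11 [B14];
route `BalabanUVNodes`, key item K1⁷ `StabilityBAtRecordR13SepCoPH` = stmt-QuantumFields-20542 (helper lane, `--kind proof --supports 20542 --as helper`, count-neutral).
[I] = [Balaban1987RG1], [III] = [Balaban1988Convergent].  Bus: CLAIM-3 = INTENT-3 of this seat (R455 (A)), DECL-DELTA-3 (split 3a ∕ 3b ∕ 3c by the 400-line rule).  File 3b of this seat's private-coordinate road (file 1 p620673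
`…N11TransportOfRecordInPrivateCoordinateChart`: the FULL-lattice chart for dag-n11-d's per-density socket; file 2 p622229 `…N11PerBondInverseLawsOfRecordAC`: the inverse laws from
absolute continuity by kernel Radon–Nikodym).  Over dag-n11-d g14's `…N11TStepOfRecordSeparated` (p616225: def-T's (†) read through the bond-partition presentation `(sV, sV′)` of a
saturated region IS 11a's `kernelRTOfRecord` applied to the INNER READING of the graph integrand — GIVEN an inner fibre chart `(X, κ, Ψ, J, S; hpush, hfib)` of the presented
carriers), dag-n11-e g21's `Node00/AveragingSkewPresentation` (p612977: the glue `e_sV = piEquivPiSubtypeProd`, `centralBond_mem_bondsIn_iff`, measurability of the rest factor)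
dag-n09-w6 g3's `T4TriangularFibredChart` (p616307) through this seat's file 3a `…N11PrivateCoordinateChartKeptParameter` (the chart with a KEPT outside parameter).

WHY THIS FILE.  Files 1–2 chart the FULL averaging: every central bond `β(c)` is resampled, the outside ones too — honest, but NOT what the (O3′) ∕ BranchSum chain reads
(p616225 → p617211 → p619836 ∕ p620817: `hin` ∕ `hinnerSum` are INNER readings of the SEPARATED transport, [III] (2.21)'s «`∫dV|_{Ω^c} δ(V̄V′⁻¹) … ∫dA|_{Ω} …`»: the outside fine
field `y = U|_{sV}` is transported by 11a's un-charted `kernelRTOfRecord`, only the inside is charted).  THIS FILE puts the private-coordinate chart exactly there: for a fine region `Y`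
saturated at level `k+1` with bond sets `sV ↔ bondsIn k Y`, `sV′ ↔ bondsIn (k+1) Y`, the coarse bonds OFF `sV′` have their central bonds OFF `sV` (`centralBond_mem_bondsIn_iff`), the
rest factor `r ↦ (Ū(e_sV⁻¹(y, r)) c)_{c ∉ sV′}` is LOCAL in those private coordinates for every outside field `y` (`isLocal_avgFun` through the glue), and dag-n09-w6's engine —
run PER OUTSIDE FIELD `y` and integrated over `y` (file 3a) — yields the inner chart with `X :=` the off-`sV` fine configurations, CONSTANT fibre reference `κ := Kernel.const _ (⊗_{b ∉ sV} Haar)`,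
`Ψ ((y, v₂), r) := extend β′ (c ↦ ϑ_c(e_sV⁻¹(y,r), v₂ c)) r` (`β′ c = centralBond c` as an off-`sV` bond), `J := 𝟙[∀ c ∉ sV′, v₂ c ∈ T_c]·∏_{c ∉ sV′} j_c`, charted set
`S := {(y, r) | ∀ c ∉ sV′, r(β′ c) ∈ Ω_c(e_sV⁻¹(y,r))}` — from the SAME full-lattice per-bond inversion data `(Ω, T, ϑ, j)` as files 1–2, USED ONLY AT `c ∉ sV′`.  So p616225's
★★★★ gives def-T's (†) through `e_{sV′}` as «11a's `kernelRTOfRecord` of the resampled `dr`-integral of the (†)-integrand», `dV′`-a.e., with the support clause `hwS` on the step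
weights seeing ONLY the inside private coordinates (where the small-field restrictions (3.2)–(3.5) act).

WHAT THIS FILE PROVES (0 `def`, 0 `sorry`, standard axioms; the generic engine — fibrewise chart identities integrate over a kept parameter; p616307 per outside value — is file 3a
`…N11PrivateCoordinateChartKeptParameter`: `triChart_param_map_eq_restrict`, `ae_apply_triChart_param_eq`).
§1 (glue plumbing; [folklore], the of-record twins are p612977's private §1 lemmas) `glue_symm_update_snd` · `glue_symm_extend_off` (resampling the off-`sV′` central bonds through the
glue = a TOTAL resampling `extend centralBond g′` of the glued field with `g′ = ` old values on `sV′`).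
§2 (record, `k < K`) `centralBond_not_mem_of_not_mem` · `isLocal_glueRest` · ★★★ `hpush_innerPrivateChart` · ★★ `hfib_innerPrivateChart` (p616225's two displayed hypotheses LITERALLY) ·
`measurable_innerPrivateChart` · `measurable_innerPrivateJacobian`.  The endpoint over p616225 (`tstepOfRecord … ∘ e_{sV′} =ᵐ kernelRTOfRecord …` BY NAME) and the ∃-`jd` edition over
file 2 are file 3c `…N11InnerTransportInPrivateCoordinateChart`.

HONEST FRAMING.  Helper lane of K1⁷; count-neutral; kernel measure theory BY NAME; per-bond windows ∕ inverses `(Ω, T, ϑ; hΩm hΩbl hTm hθm hright [hleft, hΩT])` and (§3 main) the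
density `j` with `hlaw` are HYPOTHESES (dag-n09-w6's in-flight files; file 2); the saturation `hY` and the bond sets `hsV`∕`hsV′` are displayed as in p616225; the step weights'
measurability ∕ integrability ∕ support clause are displayed; NO chart of Bałaban's ((47), [III] (3.10)–(3.25)) is asserted — a valid inner chart of the disintegration, not print's;
(B4) ∕ (S-α) ∕ (O3′) NOT closed; N11 NOT discharged; K1⁷ ∕ K1⁸ NOT closed, no registered stub touched; counts unmoved (typed 28∕28 · discharged 5∕27 · A 5∕28).  No summit statement is
proved by this seat.  One finite `𝕋⁴_{L^K}` programme at fixed `ε = L^{−K}`; R4 closes only the conditional finite-𝕋⁴ rung `BalabanLadder.UV` — NOT ℝ⁴, NOT OS, NOT a mass gap, NOT Clay.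
No `sorry`, `axiom`, `def`, `instance`, `notation`.  The binder `[DecidableEq (PBond (F.P K) (k + 1))]` of §2 is bookkeeping: it pins the `Fintype {c // c ∉ sV′}` instance to the
consumer's local one (p616225's), avoiding a definitional mismatch with the tree's global `instDecidableEqPBond` (cf. `B15Prop1IntrinsicAtCoPRecord` header).
Sources (SHAPE ∕ bookkeeping only): [I] (0.4) p.253, (2.4) p.266, (2.10) p.267; [III] (2.21) p.258, (3.1) p.264, (3.2)–(3.5) p.265, p.267 L18–24, (3.24)–(3.25) p.270.
-/

noncomputable section

open MeasureTheory ProbabilityTheory Set Function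
open scoped ENNReal NNReal

namespace Summit.QuantumFields.YangMills.Theorems.BalabanUVNodesN11InnerPrivateCoordinateChartSocket

open Literature.MathematicalPhysics.QuantumFieldTheory.Balaban1983to89
open Literature.MathematicalPhysics.QuantumFieldTheory.Balaban1983to89.T4AveragingDisintegration
open Literature.MathematicalPhysics.QuantumFieldTheory.Balaban1983to89.T4TriangularPushforward (IsLocal)
open Summit.QuantumFields.YangMills.Theorems.BalabanUVNodesN11PrivateCoordinateChartKeptParameter
open Literature.MathematicalPhysics.QuantumFieldTheory.Balaban1983to89.BlockAveragingHaarAC (centralBond centralBond_injective isLocal_avgFun)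
open Literature.MathematicalPhysics.QuantumFieldTheory.Balaban1983to89.ExpMeanLog (expMeanLogSU)
open Summit.QuantumFields.YangMills.Theorems.BalabanUVNodesN11TransportOfRecordInPrivateCoordinateChart (succ_le_m_add_K)

/-! ## §1  Glue plumbing ([folklore]; the of-record twins are p612977's private §1 lemmas) -/

section Glue

open Node00 hiding SU
open T4Continuum

variable {P : Params} {j : ℕ} {G : Type*} [MeasurableSpace G] [DecidableEq (PBond P j)]

/-- The glue reads an `s`-coordinate off the first component, an off-`s` coordinate off the second (p612977's `piEquivPiSubtypeProd_symm_apply_of_mem ∕ _of_not_mem`).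
[cite: Balaban1988Convergent, (2.21) p.258 (bookkeeping)] -/
theorem glue_symm_apply (s : Finset (PBond P j)) (q : (↥s → G) × ({b : PBond P j // b ∉ s} → G)) (b : PBond P j) :
    (MeasurableEquiv.piEquivPiSubtypeProd (fun _ : PBond P j => G) (· ∈ s)).symm q b =
      if h : b ∈ s then q.1 ⟨b, h⟩ else q.2 ⟨b, h⟩ := rfl

/-- Updating an off-`s` coordinate of the datum updates that bond of the glued field (p612977's private `piEquivPiSubtypeProd_symm_update_snd`, re-derived).
[cite: Balaban1988Convergent, (2.21) p.258 (bookkeeping)] -/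
theorem glue_symm_update_snd (s : Finset (PBond P j)) (y : ↥s → G) (r : {b : PBond P j // b ∉ s} → G) (b : {b : PBond P j // b ∉ s}) (g : G) :
    (MeasurableEquiv.piEquivPiSubtypeProd (fun _ : PBond P j => G) (· ∈ s)).symm (y, update r b g) =
      update ((MeasurableEquiv.piEquivPiSubtypeProd (fun _ : PBond P j => G) (· ∈ s)).symm (y, r)) b g := by
  funext i
  by_cases hib : i = (b : PBond P j)
  · subst hib
    rw [update_self, glue_symm_apply, dif_neg b.2]
    simp only [Subtype.coe_eta, update_self]
  · rw [update_of_ne hib, glue_symm_apply, glue_symm_apply]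
    by_cases hi : i ∈ s
    · rw [dif_pos hi, dif_pos hi]
    · rw [dif_neg hi, dif_neg hi]
      exact update_of_ne (fun h => hib (congrArg Subtype.val h)) _ _

/-- **RESAMPLING THE OFF-`s′` CENTRAL BONDS THROUGH THE GLUE IS A TOTAL RESAMPLING OF THE GLUED FIELD**: for an injection `β′ : C → {b ∉ s}` whose values are central bonds
(`β′ c = centralBond (ι c)` along an injection `ι : C → PBond P (j+1)`), `e_s⁻¹(y, extend β′ g r) = extend centralBond g′ (e_s⁻¹(y, r))` with `g′ c := g ⟨…⟩` on the range of `ι` and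
`g′ c := (e_s⁻¹(y,r)) (centralBond c)` elsewhere — so a window BLIND to total resamplings is blind to the partial ones.
[cite: Balaban1987RG1, (0.4) p.253 (bookkeeping: private coordinates)] -/
theorem glue_symm_extend_off (s : Finset (PBond P j)) (hinj : Injective (centralBond : PBond P (j + 1) → PBond P j))
    {C : Type*} (ι' : C → PBond P (j + 1)) (hι : Injective ι') (hC : ∀ c, centralBond (ι' c) ∉ s)
    (y : ↥s → G) (r : {b : PBond P j // b ∉ s} → G) (g : C → G) :
    ∃ g' : PBond P (j + 1) → G,
      (MeasurableEquiv.piEquivPiSubtypeProd (fun _ : PBond P j => G) (· ∈ s)).symm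
          (y, extend (fun c => (⟨centralBond (ι' c), hC c⟩ : {b : PBond P j // b ∉ s})) g r) =
        extend centralBond g' ((MeasurableEquiv.piEquivPiSubtypeProd (fun _ : PBond P j => G) (· ∈ s)).symm (y, r)) := by
  classical
  refine ⟨extend ι' g (fun c => (MeasurableEquiv.piEquivPiSubtypeProd (fun _ : PBond P j => G) (· ∈ s)).symm (y, r) (centralBond c)), ?_⟩
  have hβ' : Injective (fun c => (⟨centralBond (ι' c), hC c⟩ : {b : PBond P j // b ∉ s})) :=
    fun c c' h => hι (hinj (congrArg Subtype.val h))
  funext i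
  by_cases hci : ∃ c, centralBond c = i
  · obtain ⟨c, rfl⟩ := hci
    rw [hinj.extend_apply]
    by_cases hc : ∃ c₀, ι' c₀ = c
    · obtain ⟨c₀, rfl⟩ := hc
      rw [hι.extend_apply, glue_symm_apply, dif_neg (hC c₀)]
      exact hβ'.extend_apply _ _ _
    · rw [extend_apply' _ _ _ hc, glue_symm_apply, glue_symm_apply]
      by_cases hi : centralBond c ∈ s
      · rw [dif_pos hi, dif_pos hi]
      · rw [dif_neg hi, dif_neg hi]
        refine extend_apply' _ _ _ ?_
        rintro ⟨c₀, hc₀⟩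
        exact hc ⟨c₀, hinj (congrArg Subtype.val hc₀)⟩
  · rw [extend_apply' _ _ _ hci, glue_symm_apply, glue_symm_apply]
    by_cases hi : i ∈ s
    · rw [dif_pos hi, dif_pos hi]
    · rw [dif_neg hi, dif_neg hi]
      refine extend_apply' _ _ _ ?_
      rintro ⟨c₀, hc₀⟩
      exact hci ⟨ι' c₀, congrArg Subtype.val hc₀⟩

end Glue

/-! ## §2  At the record: the inner private-coordinate chart of the bond-partition presentation -/

section Record

open Node00 hiding SU
open T4Continuum
open B10Eq42TorusConstraint (bondsIn)
open B10Eq38TorusDomains (toFine)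

variable {F : T4Family} {N : ℕ} [NeZero N]

omit [NeZero N] in
/-- **THE PRIVATE COORDINATES OF THE INSIDE COARSE BONDS LIE INSIDE**: for a fine region `Y` saturated at level `k+1` and bond sets `sV ↔ bondsIn k Y`, `sV′ ↔ bondsIn (k+1) Y`,
`c ∉ sV′ → centralBond c ∉ sV` (p612977 `centralBond_mem_bondsIn_iff`). [cite: Balaban1987RG1, (0.4) p.253 (bookkeeping)] -/
theorem centralBond_not_mem_of_not_mem {K k : ℕ} (hk : k + 1 ≤ (F.P K).m + (F.P K).K)
    {Y : Set (Site (F.P K) 0)} (hY : ∀ s : Site (F.P K) k, toFine k s ∈ Y ↔ toFine (k + 1) (blockOf s) ∈ Y)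
    {sV : Finset (PBond (F.P K) k)} (hsV : ∀ b : PBond (F.P K) k, b ∈ sV ↔ b ∈ bondsIn k Y)
    {sV' : Finset (PBond (F.P K) (k + 1))} (hsV' : ∀ c : PBond (F.P K) (k + 1), c ∈ sV' ↔ c ∈ bondsIn (k + 1) Y)
    {c : PBond (F.P K) (k + 1)} (hc : c ∉ sV') : centralBond c ∉ sV := fun h =>
  hc ((hsV' c).2 ((centralBond_mem_bondsIn_iff hk hY c).1 ((hsV _).1 h)))

/-- **THE REST FACTOR IS LOCAL IN THE INSIDE PRIVATE COORDINATES**, for every outside field `y`: updating the off-`sV` datum at `β′ c = centralBond c` (`c ∉ sV′`) does not change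
`Ū(e_sV⁻¹(y, r)) c′` for `c′ ≠ c` (`isLocal_avgFun` through `glue_symm_update_snd`). [cite: Balaban1987RG1, (0.4) p.253 and p.267 (bookkeeping)] -/
theorem isLocal_glueRest {K k : ℕ} [DecidableEq (PBond (F.P K) k)] [DecidableEq (PBond (F.P K) (k + 1))] (hk : k + 1 ≤ (F.P K).m + (F.P K).K)
    {sV : Finset (PBond (F.P K) k)} {sV' : Finset (PBond (F.P K) (k + 1))} (hβ' : ∀ c : PBond (F.P K) (k + 1), c ∉ sV' → centralBond c ∉ sV)
    (y : ↥sV → SU N) :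
    IsLocal (fun c : {c : PBond (F.P K) (k + 1) // c ∉ sV'} => (⟨centralBond (c : PBond (F.P K) (k + 1)), hβ' c c.2⟩ : {b : PBond (F.P K) k // b ∉ sV}))
      (fun (r : {b : PBond (F.P K) k // b ∉ sV} → SU N) (c : {c : PBond (F.P K) (k + 1) // c ∉ sV'}) =>
        (avOfRecord F N K k).avg ((MeasurableEquiv.piEquivPiSubtypeProd (fun _ : PBond (F.P K) k => SU N) (· ∈ sV)).symm (y, r)) c) := by
  intro r c g c' hc'
  show (avOfRecord F N K k).avg ((MeasurableEquiv.piEquivPiSubtypeProd (fun _ : PBond (F.P K) k => SU N) (· ∈ sV)).symm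
      (y, update r ⟨centralBond (c : PBond (F.P K) (k + 1)), hβ' c c.2⟩ g)) c' =
    (avOfRecord F N K k).avg ((MeasurableEquiv.piEquivPiSubtypeProd (fun _ : PBond (F.P K) k => SU N) (· ∈ sV)).symm (y, r)) c'
  rw [glue_symm_update_snd]
  exact isLocal_avgFun hk expMeanLogSU _ (c : PBond (F.P K) (k + 1)) g (c' : PBond (F.P K) (k + 1))
    (fun h => hc' (Subtype.ext h))

variable {K k : ℕ}
  (Ω T : PBond (F.P K) (k + 1) → GaugeField (F.P K) k (SU N) → Set (SU N))
  (ϑ : PBond (F.P K) (k + 1) → GaugeField (F.P K) k (SU N) → SU N → SU N)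
  (jd : PBond (F.P K) (k + 1) → GaugeField (F.P K) k (SU N) → SU N → ℝ≥0)

/-- **★★★ THE INNER `hpush` OF THE SEPARATED TRANSPORT AT THE RECORD, PRIVATE-COORDINATE EDITION** (p616225's first displayed hypothesis, INHABITED): at step `k < K`, for a fine
region `Y` saturated at level `k+1` with bond sets `sV ↔ bondsIn k Y`, `sV′ ↔ bondsIn (k+1) Y`, and FULL-lattice per-bond inversion data `(Ω, T, ϑ, j; hΩbl, hright, hlaw)` USED ONLY
at the coarse bonds off `sV′`: with `X :=` the off-`sV` fine configurations, `κ := Kernel.const _ (⊗_{b ∉ sV} Haar)`, `Ψ ((y,v₂),r) := extend β′ (c ↦ ϑ_c(e_sV⁻¹(y,r), v₂ c)) r`,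
`J ((y,v₂),r) := 𝟙[∀ c ∉ sV′, v₂ c ∈ T_c(e_sV⁻¹(y,r))]·∏_{c ∉ sV′} j_c(e_sV⁻¹(y,r), v₂ c)`:
`(((((⊗_{sV} Haar) ⊗ (⊗_{c ∉ sV′} Haar)) ⊗ₘ κ)·J).map (z ↦ (z.1.1, Ψ z)) = ((⊗_{sV} Haar) ⊗ (⊗_{b ∉ sV} Haar))⌊{(y,r) | ∀ c ∉ sV′, r(β′ c) ∈ Ω_c(e_sV⁻¹(y,r))}`.
[cite: Balaban1988Convergent, (2.21) p.258, (3.1) p.264, p.267 L18–24; Balaban1987RG1, (0.4) p.253, (2.10) p.267] -/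
theorem hpush_innerPrivateChart [DecidableEq (PBond (F.P K) k)] [DecidableEq (PBond (F.P K) (k + 1))] (hkK : k < K)
    {sV : Finset (PBond (F.P K) k)} {sV' : Finset (PBond (F.P K) (k + 1))}
    (hβ' : ∀ c : PBond (F.P K) (k + 1), c ∉ sV' → centralBond c ∉ sV)
    (hΩm : ∀ c, MeasurableSet {p : GaugeField (F.P K) k (SU N) × SU N | p.2 ∈ Ω c p.1})
    (hTm : ∀ c, MeasurableSet {p : GaugeField (F.P K) k (SU N) × SU N | p.2 ∈ T c p.1})
    (hθm : ∀ c, Measurable fun p : GaugeField (F.P K) k (SU N) × SU N => ϑ c p.1 p.2)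
    (hjm : ∀ c, Measurable fun p : GaugeField (F.P K) k (SU N) × SU N => jd c p.1 p.2)
    (hΩbl : ∀ c (U : GaugeField (F.P K) k (SU N)) (g : PBond (F.P K) (k + 1) → SU N), Ω c (extend centralBond g U) = Ω c U)
    (hright : ∀ c U, ∀ v ∈ T c U, (avOfRecord F N K k).avg (update U (centralBond c) (ϑ c U v)) c = v)
    (hlaw : ∀ c U, (HaarData.haar : Measure (SU N)).restrict (Ω c U) =
      (((HaarData.haar : Measure (SU N)).restrict (T c U)).withDensity fun v => (jd c U v : ℝ≥0∞)).map (ϑ c U)) :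
    ((((Measure.pi fun _ : ↥sV => (HaarData.haar : Measure (SU N))).prod
          (Measure.pi fun _ : {c : PBond (F.P K) (k + 1) // c ∉ sV'} => (HaarData.haar : Measure (SU N)))) ⊗ₘ
          Kernel.const _ (Measure.pi fun _ : {b : PBond (F.P K) k // b ∉ sV} => (HaarData.haar : Measure (SU N)))).withDensity fun z =>
          (({z : ((↥sV → SU N) × ({c : PBond (F.P K) (k + 1) // c ∉ sV'} → SU N)) × ({b : PBond (F.P K) k // b ∉ sV} → SU N) |
              ∀ c : {c : PBond (F.P K) (k + 1) // c ∉ sV'},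
                z.1.2 c ∈ T c ((MeasurableEquiv.piEquivPiSubtypeProd (fun _ : PBond (F.P K) k => SU N) (· ∈ sV)).symm (z.1.1, z.2))}.indicator
            (fun z => ∏ c : {c : PBond (F.P K) (k + 1) // c ∉ sV'},
              jd c ((MeasurableEquiv.piEquivPiSubtypeProd (fun _ : PBond (F.P K) k => SU N) (· ∈ sV)).symm (z.1.1, z.2)) (z.1.2 c)) z : ℝ≥0) : ℝ≥0∞)).map
        (fun z => (z.1.1, extend (fun c : {c : PBond (F.P K) (k + 1) // c ∉ sV'} =>
            (⟨centralBond (c : PBond (F.P K) (k + 1)), hβ' c c.2⟩ : {b : PBond (F.P K) k // b ∉ sV}))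
          (fun c : {c : PBond (F.P K) (k + 1) // c ∉ sV'} =>
            ϑ c ((MeasurableEquiv.piEquivPiSubtypeProd (fun _ : PBond (F.P K) k => SU N) (· ∈ sV)).symm (z.1.1, z.2)) (z.1.2 c)) z.2)) =
      ((Measure.pi fun _ : ↥sV => (HaarData.haar : Measure (SU N))).prod
          (Measure.pi fun _ : {b : PBond (F.P K) k // b ∉ sV} => (HaarData.haar : Measure (SU N)))).restrict
        {q | ∀ c : {c : PBond (F.P K) (k + 1) // c ∉ sV'},
          q.2 ⟨centralBond (c : PBond (F.P K) (k + 1)), hβ' c c.2⟩ ∈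
            Ω c ((MeasurableEquiv.piEquivPiSubtypeProd (fun _ : PBond (F.P K) k => SU N) (· ∈ sV)).symm q)} := by
  classical
  have hk : k + 1 ≤ (F.P K).m + (F.P K).K := succ_le_m_add_K hkK
  have he : Measurable fun q : (↥sV → SU N) × ({b : PBond (F.P K) k // b ∉ sV} → SU N) =>
      (MeasurableEquiv.piEquivPiSubtypeProd (fun _ : PBond (F.P K) k => SU N) (· ∈ sV)).symm q :=
    (MeasurableEquiv.piEquivPiSubtypeProd (fun _ : PBond (F.P K) k => SU N) (· ∈ sV)).symm.measurable
  have hβinj : Injective (fun c : {c : PBond (F.P K) (k + 1) // c ∉ sV'} =>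
      (⟨centralBond (c : PBond (F.P K) (k + 1)), hβ' c c.2⟩ : {b : PBond (F.P K) k // b ∉ sV})) :=
    fun c c' h => Subtype.ext (centralBond_injective hk (congrArg Subtype.val h))
  refine triChart_param_map_eq_restrict
    (A := fun (y : ↥sV → SU N) (r : {b : PBond (F.P K) k // b ∉ sV} → SU N) (c : {c : PBond (F.P K) (k + 1) // c ∉ sV'}) =>
      (avOfRecord F N K k).avg ((MeasurableEquiv.piEquivPiSubtypeProd (fun _ : PBond (F.P K) k => SU N) (· ∈ sV)).symm (y, r)) c)
    (fun c e => Ω c ((MeasurableEquiv.piEquivPiSubtypeProd (fun _ : PBond (F.P K) k => SU N) (· ∈ sV)).symm e))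
    (fun c e => T c ((MeasurableEquiv.piEquivPiSubtypeProd (fun _ : PBond (F.P K) k => SU N) (· ∈ sV)).symm e))
    (fun c e v => ϑ c ((MeasurableEquiv.piEquivPiSubtypeProd (fun _ : PBond (F.P K) k => SU N) (· ∈ sV)).symm e) v)
    (fun c e v => jd c ((MeasurableEquiv.piEquivPiSubtypeProd (fun _ : PBond (F.P K) k => SU N) (· ∈ sV)).symm e) v)
    (HaarData.haar : Measure (SU N)) (HaarData.haar : Measure (SU N)) _
    (fun y => isLocal_glueRest (F := F) (N := N) hk hβ' y) hβinj (measurable_avOfRecord_glue_rest F N K k sV sV')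
    (fun c => (he.comp measurable_fst |>.prodMk measurable_snd) (hΩm c))
    (fun c => (he.comp measurable_fst |>.prodMk measurable_snd) (hTm c))
    (fun c => (hθm c).comp (he.comp measurable_fst |>.prodMk measurable_snd))
    (fun c => (hjm c).comp (he.comp measurable_fst |>.prodMk measurable_snd))
    (fun c y r g => ?_) (fun c e v hv => ?_) (fun c e => hlaw c _)
  · -- blindness: a partial resampling of the off-`sV′` central bonds is a total resampling of the glued field
    obtain ⟨g', hg'⟩ := glue_symm_extend_off (G := SU N) sV (centralBond_injective hk)
      (fun c : {c : PBond (F.P K) (k + 1) // c ∉ sV'} => (c : PBond (F.P K) (k + 1))) Subtype.val_injective (fun c => hβ' c c.2) y r g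
    show Ω c ((MeasurableEquiv.piEquivPiSubtypeProd (fun _ : PBond (F.P K) k => SU N) (· ∈ sV)).symm (y, extend _ g r)) =
      Ω c ((MeasurableEquiv.piEquivPiSubtypeProd (fun _ : PBond (F.P K) k => SU N) (· ∈ sV)).symm (y, r))
    rw [hg', hΩbl]
  · -- right inverse through the glue
    show (avOfRecord F N K k).avg ((MeasurableEquiv.piEquivPiSubtypeProd (fun _ : PBond (F.P K) k => SU N) (· ∈ sV)).symm
        (e.1, update e.2 ⟨centralBond (c : PBond (F.P K) (k + 1)), hβ' c c.2⟩
          (ϑ c ((MeasurableEquiv.piEquivPiSubtypeProd (fun _ : PBond (F.P K) k => SU N) (· ∈ sV)).symm e) v))) c = v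
    rw [glue_symm_update_snd]
    exact hright c _ v hv

/-- **★★ THE INNER `hfib` AT THE RECORD** (p616225's second displayed hypothesis, INHABITED): for ANY measure `m` on the presented base, `(J · m)`-a.e. the resampled inside field
has the prescribed inside∕boundary coarse averages: `(c ↦ Ū(e_sV⁻¹(z.1.1, Ψ z)) c)_{c ∉ sV′} = z.1.2`. [cite: Balaban1987RG1, (2.4) p.266 and (2.10) p.267 (bookkeeping)] -/
theorem hfib_innerPrivateChart [DecidableEq (PBond (F.P K) k)] [DecidableEq (PBond (F.P K) (k + 1))] (hkK : k < K)
    {sV : Finset (PBond (F.P K) k)} {sV' : Finset (PBond (F.P K) (k + 1))}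
    (hβ' : ∀ c : PBond (F.P K) (k + 1), c ∉ sV' → centralBond c ∉ sV)
    (hTm : ∀ c, MeasurableSet {p : GaugeField (F.P K) k (SU N) × SU N | p.2 ∈ T c p.1})
    (hjm : ∀ c, Measurable fun p : GaugeField (F.P K) k (SU N) × SU N => jd c p.1 p.2)
    (hright : ∀ c U, ∀ v ∈ T c U, (avOfRecord F N K k).avg (update U (centralBond c) (ϑ c U v)) c = v)
    (m : Measure (((↥sV → SU N) × ({c : PBond (F.P K) (k + 1) // c ∉ sV'} → SU N)) × ({b : PBond (F.P K) k // b ∉ sV} → SU N))) :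
    ∀ᵐ z ∂(m.withDensity fun z =>
          (({z : ((↥sV → SU N) × ({c : PBond (F.P K) (k + 1) // c ∉ sV'} → SU N)) × ({b : PBond (F.P K) k // b ∉ sV} → SU N) |
              ∀ c : {c : PBond (F.P K) (k + 1) // c ∉ sV'},
                z.1.2 c ∈ T c ((MeasurableEquiv.piEquivPiSubtypeProd (fun _ : PBond (F.P K) k => SU N) (· ∈ sV)).symm (z.1.1, z.2))}.indicator
            (fun z => ∏ c : {c : PBond (F.P K) (k + 1) // c ∉ sV'},
              jd c ((MeasurableEquiv.piEquivPiSubtypeProd (fun _ : PBond (F.P K) k => SU N) (· ∈ sV)).symm (z.1.1, z.2)) (z.1.2 c)) z : ℝ≥0) : ℝ≥0∞)),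
      (fun c : {c : PBond (F.P K) (k + 1) // c ∉ sV'} =>
        (avOfRecord F N K k).avg ((MeasurableEquiv.piEquivPiSubtypeProd (fun _ : PBond (F.P K) k => SU N) (· ∈ sV)).symm
          (z.1.1, extend (fun c : {c : PBond (F.P K) (k + 1) // c ∉ sV'} =>
              (⟨centralBond (c : PBond (F.P K) (k + 1)), hβ' c c.2⟩ : {b : PBond (F.P K) k // b ∉ sV}))
            (fun c : {c : PBond (F.P K) (k + 1) // c ∉ sV'} =>
            ϑ c ((MeasurableEquiv.piEquivPiSubtypeProd (fun _ : PBond (F.P K) k => SU N) (· ∈ sV)).symm (z.1.1, z.2)) (z.1.2 c)) z.2)) c) =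
        z.1.2 := by
  classical
  have hk : k + 1 ≤ (F.P K).m + (F.P K).K := succ_le_m_add_K hkK
  have he : Measurable fun q : (↥sV → SU N) × ({b : PBond (F.P K) k // b ∉ sV} → SU N) =>
      (MeasurableEquiv.piEquivPiSubtypeProd (fun _ : PBond (F.P K) k => SU N) (· ∈ sV)).symm q :=
    (MeasurableEquiv.piEquivPiSubtypeProd (fun _ : PBond (F.P K) k => SU N) (· ∈ sV)).symm.measurable
  have hβinj : Injective (fun c : {c : PBond (F.P K) (k + 1) // c ∉ sV'} =>
      (⟨centralBond (c : PBond (F.P K) (k + 1)), hβ' c c.2⟩ : {b : PBond (F.P K) k // b ∉ sV})) :=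
    fun c c' h => Subtype.ext (centralBond_injective hk (congrArg Subtype.val h))
  refine ae_apply_triChart_param_eq
    (A := fun (y : ↥sV → SU N) (r : {b : PBond (F.P K) k // b ∉ sV} → SU N) (c : {c : PBond (F.P K) (k + 1) // c ∉ sV'}) =>
      (avOfRecord F N K k).avg ((MeasurableEquiv.piEquivPiSubtypeProd (fun _ : PBond (F.P K) k => SU N) (· ∈ sV)).symm (y, r)) c)
    (fun c e => T c ((MeasurableEquiv.piEquivPiSubtypeProd (fun _ : PBond (F.P K) k => SU N) (· ∈ sV)).symm e))
    (fun c e v => ϑ c ((MeasurableEquiv.piEquivPiSubtypeProd (fun _ : PBond (F.P K) k => SU N) (· ∈ sV)).symm e) v)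
    (fun c e v => jd c ((MeasurableEquiv.piEquivPiSubtypeProd (fun _ : PBond (F.P K) k => SU N) (· ∈ sV)).symm e) v)
    (fun y => isLocal_glueRest (F := F) (N := N) hk hβ' y) hβinj (fun c e v hv => ?_)
    (fun c => (he.comp measurable_fst |>.prodMk measurable_snd) (hTm c))
    (fun c => (hjm c).comp (he.comp measurable_fst |>.prodMk measurable_snd)) m
  show (avOfRecord F N K k).avg ((MeasurableEquiv.piEquivPiSubtypeProd (fun _ : PBond (F.P K) k => SU N) (· ∈ sV)).symm
      (e.1, update e.2 ⟨centralBond (c : PBond (F.P K) (k + 1)), hβ' c c.2⟩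
        (ϑ c ((MeasurableEquiv.piEquivPiSubtypeProd (fun _ : PBond (F.P K) k => SU N) (· ∈ sV)).symm e) v))) c = v
  rw [glue_symm_update_snd]
  exact hright c _ v hv


omit [NeZero N] in
/-- The inner private-coordinate chart `((y,v₂),r) ↦ extend β′ (c ↦ ϑ_c(e_sV⁻¹(y,r), v₂ c)) r` is measurable (file 3a `measurable_triChartParam`).
[cite: Balaban1987RG1, (2.10) p.267 (bookkeeping: measurability)] -/
theorem measurable_innerPrivateChart [DecidableEq (PBond (F.P K) k)] [DecidableEq (PBond (F.P K) (k + 1))] (hk : k + 1 ≤ (F.P K).m + (F.P K).K)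
    {sV : Finset (PBond (F.P K) k)} {sV' : Finset (PBond (F.P K) (k + 1))}
    (hβ' : ∀ c : PBond (F.P K) (k + 1), c ∉ sV' → centralBond c ∉ sV)
    (hθm : ∀ c, Measurable fun p : GaugeField (F.P K) k (SU N) × SU N => ϑ c p.1 p.2) :
    Measurable fun z : ((↥sV → SU N) × ({c : PBond (F.P K) (k + 1) // c ∉ sV'} → SU N)) × ({b : PBond (F.P K) k // b ∉ sV} → SU N) =>
      extend (fun c : {c : PBond (F.P K) (k + 1) // c ∉ sV'} =>
          (⟨centralBond (c : PBond (F.P K) (k + 1)), hβ' c c.2⟩ : {b : PBond (F.P K) k // b ∉ sV}))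
        (fun c : {c : PBond (F.P K) (k + 1) // c ∉ sV'} =>
          ϑ c ((MeasurableEquiv.piEquivPiSubtypeProd (fun _ : PBond (F.P K) k => SU N) (· ∈ sV)).symm (z.1.1, z.2)) (z.1.2 c)) z.2 := by
  have he : Measurable fun q : (↥sV → SU N) × ({b : PBond (F.P K) k // b ∉ sV} → SU N) =>
      (MeasurableEquiv.piEquivPiSubtypeProd (fun _ : PBond (F.P K) k => SU N) (· ∈ sV)).symm q :=
    (MeasurableEquiv.piEquivPiSubtypeProd (fun _ : PBond (F.P K) k => SU N) (· ∈ sV)).symm.measurable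
  have hβinj : Injective (fun c : {c : PBond (F.P K) (k + 1) // c ∉ sV'} =>
      (⟨centralBond (c : PBond (F.P K) (k + 1)), hβ' c c.2⟩ : {b : PBond (F.P K) k // b ∉ sV})) :=
    fun c c' h => Subtype.ext (centralBond_injective hk (congrArg Subtype.val h))
  exact measurable_triChartParam
    (fun (c : {c : PBond (F.P K) (k + 1) // c ∉ sV'}) e v =>
      ϑ c ((MeasurableEquiv.piEquivPiSubtypeProd (fun _ : PBond (F.P K) k => SU N) (· ∈ sV)).symm e) v) hβinj
    (fun c => (hθm c).comp (he.comp measurable_fst |>.prodMk measurable_snd))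

omit [NeZero N] in
/-- The inner private-coordinate Jacobian `((y,v₂),r) ↦ 𝟙[∀ c ∉ sV′, v₂ c ∈ T_c(e_sV⁻¹(y,r))]·∏_{c ∉ sV′} j_c(e_sV⁻¹(y,r), v₂ c)` is measurable (file 3a `measurable_triJacobianParam`).
[cite: Balaban1987RG1, (2.10) p.267 (bookkeeping: measurability)] -/
theorem measurable_innerPrivateJacobian [DecidableEq (PBond (F.P K) k)] [DecidableEq (PBond (F.P K) (k + 1))]
    {sV : Finset (PBond (F.P K) k)} {sV' : Finset (PBond (F.P K) (k + 1))}
    (hTm : ∀ c, MeasurableSet {p : GaugeField (F.P K) k (SU N) × SU N | p.2 ∈ T c p.1})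
    (hjm : ∀ c, Measurable fun p : GaugeField (F.P K) k (SU N) × SU N => jd c p.1 p.2) :
    Measurable fun z : ((↥sV → SU N) × ({c : PBond (F.P K) (k + 1) // c ∉ sV'} → SU N)) × ({b : PBond (F.P K) k // b ∉ sV} → SU N) =>
      {z : ((↥sV → SU N) × ({c : PBond (F.P K) (k + 1) // c ∉ sV'} → SU N)) × ({b : PBond (F.P K) k // b ∉ sV} → SU N) |
          ∀ c : {c : PBond (F.P K) (k + 1) // c ∉ sV'},
            z.1.2 c ∈ T c ((MeasurableEquiv.piEquivPiSubtypeProd (fun _ : PBond (F.P K) k => SU N) (· ∈ sV)).symm (z.1.1, z.2))}.indicator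
        (fun z => ∏ c : {c : PBond (F.P K) (k + 1) // c ∉ sV'},
          jd c ((MeasurableEquiv.piEquivPiSubtypeProd (fun _ : PBond (F.P K) k => SU N) (· ∈ sV)).symm (z.1.1, z.2)) (z.1.2 c)) z := by
  have he : Measurable fun q : (↥sV → SU N) × ({b : PBond (F.P K) k // b ∉ sV} → SU N) =>
      (MeasurableEquiv.piEquivPiSubtypeProd (fun _ : PBond (F.P K) k => SU N) (· ∈ sV)).symm q :=
    (MeasurableEquiv.piEquivPiSubtypeProd (fun _ : PBond (F.P K) k => SU N) (· ∈ sV)).symm.measurable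
  exact measurable_triJacobianParam
    (fun (c : {c : PBond (F.P K) (k + 1) // c ∉ sV'}) e =>
      T c ((MeasurableEquiv.piEquivPiSubtypeProd (fun _ : PBond (F.P K) k => SU N) (· ∈ sV)).symm e))
    (fun (c : {c : PBond (F.P K) (k + 1) // c ∉ sV'}) e v =>
      jd c ((MeasurableEquiv.piEquivPiSubtypeProd (fun _ : PBond (F.P K) k => SU N) (· ∈ sV)).symm e) v)
    (fun c => (he.comp measurable_fst |>.prodMk measurable_snd) (hTm c))
    (fun c => (hjm c).comp (he.comp measurable_fst |>.prodMk measurable_snd))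

end Record

end Summit.QuantumFields.YangMills.Theorems.BalabanUVNodesN11InnerPrivateCoordinateChartSocket

end
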